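import Summits.HubbardSuperconductivity.HubbardSuperconductivity.Theorems.BalabanIRBirSliceXYOrderRPFourier
import Summits.HubbardSuperconductivity.HubbardSuperconductivity.Theorems.BalabanIRBirSliceXYOrderRPSums
import Literature.Probability.LatticeModels.GaussianDomination
import HarnessLib

/-!
# Crux `BirComplexStableXYR` (stmt-HubbardSuperconductivity-14845): the slice Poincaré inequality
# `1 - |L⁻² Σ_x e^{iθ_x}|² ≤ ¼ Σ_{x,i} (1 - cos(θ_{x+eᵢ} - θ_x))` on `(ℤ/L)²`

Support file (prover seat 0, route BalabanIR).  The slice-magnetisation DEFICIT `D = 1 - O` of a time slice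
(`O = |L⁻² Σ_x e^{iθ(x)}|²`, the crux's equal-time observable) is controlled by the slice's own nearest-neighbour
XY energy `E = Σ_{x,i} (1 - cos(θ_{x+eᵢ} - θ_x))`: `D ≤ E/4` (`slice_deficit_le_energy`).  This is the discrete
Poincaré inequality on the torus `(ℤ/L)²` (`slice_poincare`: `Σ_x ‖z_x - z̄‖² ≤ (L²/8) Σ_{x,i} ‖z_{x+eᵢ} - z_x‖²`,
spectral gap `2·ε(k) ≥ 8/L²` of the lattice Laplacian at `k ≠ 0`) applied to `z_x = e^{iθ_x}`.  It is the
"SlicePoincare" ingredient of idea card `Cruxes/BirComplexStableXYR/Ideas/coercivity-budget-jensen-transfer.md`: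
together with the window coercivity (C) it shows that the deficit reward `e^{hD}`, `h = ηK` with `η ≤ 4·(spatial
coercive budget)`, is dominated pointwise by the coercive part of `Re A` — the rewarded action of the Jensen transfer
(`…BirComplexStableXYRJensenTransfer`) stays in the stability class.  Tools: Plancherel on `(ℤ/L)^d`
(`BirSliceXY.sum_norm_sq_sum_mul_torusChar`), the shift rule for characters, `‖1 - χ_k(eᵢ)‖² = 2(1 - cos pᵢ)`
(`torusChar_single`, `normSq_one_sub_exp_mul_I`) and the Jordan bound `ε(2πk/L) ≥ 4μ(k)²/L²`
(`BirSliceXY.maxnorm_sq_le_dispersion`, `one_le_maxnorm`).  [folklore]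
-/

noncomputable section

namespace Summit.HubbardSuperconductivity.HubbardSuperconductivity.Theorems

open scoped BigOperators ComplexConjugate
open Literature.Probability.LatticeModels

section SlicePoincare

variable {L : ℕ} [NeZero L]

/-- Shift rule: `Σ_x (z(x+e) - z(x)) χ_k(x) = (conj χ_k(e) - 1) Σ_x z(x) χ_k(x)`. [folklore] -/
theorem poinc_sum_diff_mul_torusChar {d : ℕ} (k e : TorusSite d L) (z : TorusSite d L → ℂ) :
    ∑ x, (z (x + e) - z x) * torusChar k x = (conj (torusChar k e) - 1) * ∑ x, z x * torusChar k x := by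
  have hshift : ∑ x, z (x + e) * torusChar k x = conj (torusChar k e) * ∑ x, z x * torusChar k x := by
    rw [Finset.mul_sum, ← Equiv.sum_comp (Equiv.subRight e) (fun x => z (x + e) * torusChar k x)]
    refine Finset.sum_congr rfl fun x _ => ?_
    simp only [Equiv.subRight_apply, sub_add_cancel]
    rw [torusChar_sub_right]
    ring
  simp_rw [sub_mul, Finset.sum_sub_distrib, hshift]
  ring

/-- `‖conj χ_k(eᵢ) - 1‖² = 2 (1 - cos pᵢ)`, `p = 2πk/L` (`L ≥ 2`). [folklore] -/
theorem poinc_normSq_conj_torusChar_single_sub_one {d : ℕ} (hL : 2 ≤ L) (k : TorusSite d L) (i : Fin d) :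
    ‖conj (torusChar k (Pi.single i 1)) - 1‖ ^ 2 = 2 * (1 - Real.cos (latticeMomentum L k i)) := by
  have : conj (torusChar k (Pi.single i 1)) - 1 = -conj (1 - torusChar k (Pi.single i 1)) := by
    rw [map_sub, map_one]; ring
  rw [this, norm_neg, Complex.norm_conj, torusChar_single hL, ← Complex.normSq_eq_norm_sq,
    normSq_one_sub_exp_mul_I]

/-- **Discrete Poincaré inequality on `(ℤ/L)²`.** For every `z : (ℤ/L)² → ℂ` (`L ≥ 2`):
`Σ_x ‖z_x - L⁻² Σ_y z_y‖² ≤ (L²/8) Σ_x Σ_i ‖z_{x+eᵢ} - z_x‖²` — Plancherel and the spectral gap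
`2 ε(2πk/L) ≥ 8/L²` (`k ≠ 0`) of the lattice Laplacian. [folklore] -/
theorem slice_poincare (hL : 2 ≤ L) (z : TorusSite 2 L → ℂ) :
    ∑ x, ‖z x - (∑ y, z y) / ((L : ℂ) ^ 2)‖ ^ 2 ≤
      (L : ℝ) ^ 2 / 8 * ∑ x, ∑ i : Fin 2, ‖z (x + Pi.single i 1) - z x‖ ^ 2 := by
  have hL0 : (0 : ℝ) < L := by exact_mod_cast Nat.pos_of_ne_zero (NeZero.ne L)
  have hLC : ((L : ℂ) ^ 2) ≠ 0 := pow_ne_zero _ (Nat.cast_ne_zero.2 (NeZero.ne L))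
  set S : ℂ := ∑ y, z y with hS
  set g : TorusSite 2 L → ℂ := fun x => z x - S / ((L : ℂ) ^ 2) with hg
  -- Fourier coefficients
  have hz0 : ∑ x, z x * torusChar 0 x = S := by simp [hS]
  have hghat : ∀ k, ∑ x, g x * torusChar k x =
      if k = 0 then 0 else ∑ x, z x * torusChar k x := by
    intro k
    have hsplit : ∑ x, g x * torusChar k x =
        ∑ x, z x * torusChar k x - S / ((L : ℂ) ^ 2) * ∑ x, torusChar k x := by
      rw [Finset.mul_sum, ← Finset.sum_sub_distrib]
      refine Finset.sum_congr rfl fun x _ => ?_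
      simp only [hg]
      ring
    rw [hsplit, sum_torusChar_right]
    by_cases hk : k = 0
    · subst hk
      rw [if_pos rfl, if_pos rfl, hz0, div_mul_cancel₀ _ hLC, sub_self]
    · rw [if_neg hk, if_neg hk, mul_zero, sub_zero]
  -- Plancherel for `g` and for the gradients
  have hPg := BirSliceXY.sum_norm_sq_sum_mul_torusChar (d := 2) (L := L) g
  have hPd : ∀ i : Fin 2, ∑ k, ‖∑ x, (z (x + Pi.single i 1) - z x) * torusChar k x‖ ^ 2 =
      (L : ℝ) ^ 2 * ∑ x, ‖z (x + Pi.single i 1) - z x‖ ^ 2 := fun i =>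
    BirSliceXY.sum_norm_sq_sum_mul_torusChar (d := 2) (L := L) (fun x => z (x + Pi.single i 1) - z x)
  -- the gradient side in Fourier space
  have hgrad : (L : ℝ) ^ 2 * ∑ x, ∑ i : Fin 2, ‖z (x + Pi.single i 1) - z x‖ ^ 2 =
      ∑ k, 2 * dispersion (latticeMomentum L k) * ‖∑ x, z x * torusChar k x‖ ^ 2 := by
    rw [Finset.sum_comm, Finset.mul_sum]
    simp_rw [← hPd, poinc_sum_diff_mul_torusChar, norm_mul, mul_pow,
      poinc_normSq_conj_torusChar_single_sub_one hL]
    rw [Finset.sum_comm]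
    refine Finset.sum_congr rfl fun k _ => ?_
    rw [dispersion, Finset.mul_sum, Finset.sum_mul, Fin.sum_univ_two]
  -- spectral gap at `k ≠ 0`
  have hgap : ∀ k : TorusSite 2 L, k ≠ 0 → 8 / (L : ℝ) ^ 2 ≤ 2 * dispersion (latticeMomentum L k) := by
    intro k hk
    have h1 := BirSliceXY.maxnorm_sq_le_dispersion k
    have h2 : (1 : ℝ) ≤ ((max (min (k 0).val (L - (k 0).val)) (min (k 1).val (L - (k 1).val)) : ℕ) : ℝ) := by
      exact_mod_cast BirSliceXY.one_le_maxnorm hk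
    have h3 : 4 / (L : ℝ) ^ 2 ≤ 4 * ((max (min (k 0).val (L - (k 0).val)) (min (k 1).val (L - (k 1).val)) : ℕ) : ℝ) ^ 2 /
        (L : ℝ) ^ 2 := div_le_div_of_nonneg_right (by nlinarith) (by positivity)
    have h4 : 8 / (L : ℝ) ^ 2 = 2 * (4 / (L : ℝ) ^ 2) := by ring
    linarith
  -- compare mode by mode
  have hmode : ∀ k : TorusSite 2 L, 8 / (L : ℝ) ^ 2 * ‖∑ x, g x * torusChar k x‖ ^ 2 ≤
      2 * dispersion (latticeMomentum L k) * ‖∑ x, z x * torusChar k x‖ ^ 2 := by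
    intro k
    rw [hghat k]
    split_ifs with hk
    · simp only [norm_zero, ne_eq, OfNat.ofNat_ne_zero, not_false_eq_true, zero_pow, mul_zero]
      exact mul_nonneg (mul_nonneg (by norm_num) (dispersion_nonneg _)) (sq_nonneg _)
    · exact mul_le_mul_of_nonneg_right (hgap k hk) (sq_nonneg _)
  have hsum := Finset.sum_le_sum fun k (_ : k ∈ Finset.univ) => hmode k
  rw [← Finset.mul_sum, hPg, ← hgrad] at hsum
  -- `8/L² · L² Σ‖g‖² ≤ L² Σ‖δz‖²`
  have h8 : 8 / (L : ℝ) ^ 2 * ((L : ℝ) ^ 2 * ∑ x, ‖g x‖ ^ 2) = 8 * ∑ x, ‖g x‖ ^ 2 := by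
    field_simp
  rw [h8] at hsum
  have : ∑ x, ‖g x‖ ^ 2 ≤ (L : ℝ) ^ 2 / 8 * ∑ x, ∑ i : Fin 2, ‖z (x + Pi.single i 1) - z x‖ ^ 2 := by
    rw [div_mul_eq_mul_div, le_div_iff₀ (by norm_num : (0:ℝ) < 8)]
    linarith
  simpa [hg] using this

/-- **Slice deficit ≤ slice energy / 4.**  For every `θ : (ℤ/L)² → ℝ` (`L ≥ 2`):
`1 - |Σ_x e^{iθ_x}|²/L⁴ ≤ ¼ Σ_x Σ_i (1 - cos(θ_{x+eᵢ} - θ_x))` — the deficit of the crux's equal-time slice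
order is bounded by a quarter of the slice's nearest-neighbour XY energy (Poincaré on `(ℤ/L)²` for `z_x = e^{iθ_x}`).
[folklore] -/
theorem slice_deficit_le_energy (hL : 2 ≤ L) (θ : TorusSite 2 L → ℝ) :
    1 - ‖∑ x, Complex.exp (Complex.I * (θ x : ℂ))‖ ^ 2 / (L : ℝ) ^ 4 ≤
      (1 / 4 : ℝ) * ∑ x, ∑ i : Fin 2, (1 - Real.cos (θ (x + Pi.single i 1) - θ x)) := by
  have hL0 : (0 : ℝ) < L := by exact_mod_cast Nat.pos_of_ne_zero (NeZero.ne L)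
  set z : TorusSite 2 L → ℂ := fun x => Complex.exp (Complex.I * (θ x : ℂ)) with hz
  have hP := slice_poincare hL z
  -- `‖z (x+e) - z x‖² = 2 (1 - cos(θ(x+e) - θ x))`
  have hdiff : ∀ x (i : Fin 2), ‖z (x + Pi.single i 1) - z x‖ ^ 2 =
      2 * (1 - Real.cos (θ (x + Pi.single i 1) - θ x)) := by
    intro x i
    have : z (x + Pi.single i 1) - z x =
        -(Complex.exp (Complex.I * (θ x : ℂ)) * (1 - Complex.exp ((θ (x + Pi.single i 1) - θ x : ℝ) * Complex.I))) := by
      simp only [hz]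
      rw [mul_sub, mul_one, ← Complex.exp_add]
      push_cast
      ring_nf
    rw [this, norm_neg, norm_mul, mul_pow, mul_comm Complex.I, Complex.norm_exp_ofReal_mul_I, one_pow, one_mul,
      ← Complex.normSq_eq_norm_sq, normSq_one_sub_exp_mul_I]
  -- `Σ ‖z x - S/L²‖² = L² - ‖S‖²/L²`
  set S : ℂ := ∑ y, z y with hS
  have hzn : ∀ x, ‖z x‖ = 1 := fun x => by
    simp only [hz]; rw [mul_comm, Complex.norm_exp_ofReal_mul_I]
  have hcard : (Finset.univ : Finset (TorusSite 2 L)).card = L ^ 2 := by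
    simp [Finset.card_univ, Fintype.card_fin, ZMod.card]
  have hLC : ((L : ℂ) ^ 2) ≠ 0 := pow_ne_zero _ (Nat.cast_ne_zero.2 (NeZero.ne L))
  have hdev : ∑ x, ‖z x - S / ((L : ℂ) ^ 2)‖ ^ 2 = (L : ℝ) ^ 2 - ‖S‖ ^ 2 / (L : ℝ) ^ 2 := by
    set m : ℂ := S / ((L : ℂ) ^ 2) with hm
    have hSm : S = ((L : ℂ) ^ 2) * m := by rw [hm, mul_div_cancel₀ _ hLC]
    have hpt : ∀ x, ‖z x - m‖ ^ 2 = 1 + ‖m‖ ^ 2 - 2 * (z x * conj m).re := by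
      intro x
      rw [← Complex.normSq_eq_norm_sq, Complex.normSq_sub, Complex.normSq_eq_norm_sq, hzn x, one_pow,
        Complex.normSq_eq_norm_sq]
    have hre : (S * conj m).re = (L : ℝ) ^ 2 * ‖m‖ ^ 2 := by
      rw [hSm, mul_assoc, Complex.mul_conj, Complex.normSq_eq_norm_sq]
      have : ((L : ℂ) ^ 2 * ((‖m‖ ^ 2 : ℝ) : ℂ)) = (((L : ℝ) ^ 2 * ‖m‖ ^ 2 : ℝ) : ℂ) := by push_cast; ring
      rw [this, Complex.ofReal_re]
    have hmn : ‖m‖ ^ 2 = ‖S‖ ^ 2 / (L : ℝ) ^ 4 := by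
      rw [hm, norm_div, div_pow, norm_pow, Complex.norm_natCast, ← pow_mul]
    rw [Finset.sum_congr rfl fun x _ => hpt x, Finset.sum_sub_distrib, Finset.sum_const, hcard,
      ← Finset.mul_sum, ← Complex.re_sum, ← Finset.sum_mul, ← hS, hre, hmn, nsmul_eq_mul]
    push_cast
    field_simp
    ring
  rw [hdev] at hP
  simp_rw [hdiff] at hP
  have hE : ∑ x, ∑ i : Fin 2, 2 * (1 - Real.cos (θ (x + Pi.single i 1) - θ x)) =
      2 * ∑ x, ∑ i : Fin 2, (1 - Real.cos (θ (x + Pi.single i 1) - θ x)) := by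
    rw [Finset.mul_sum]
    refine Finset.sum_congr rfl fun x _ => ?_
    rw [Finset.mul_sum]
  rw [hE] at hP
  -- divide by `L²`
  have hL2 : (0 : ℝ) < (L : ℝ) ^ 2 := by positivity
  have key : (L : ℝ) ^ 2 * (1 - ‖S‖ ^ 2 / (L : ℝ) ^ 4) ≤
      (L : ℝ) ^ 2 * ((1 / 4 : ℝ) * ∑ x, ∑ i : Fin 2, (1 - Real.cos (θ (x + Pi.single i 1) - θ x))) := by
    have e1 : (L : ℝ) ^ 2 * (1 - ‖S‖ ^ 2 / (L : ℝ) ^ 4) = (L : ℝ) ^ 2 - ‖S‖ ^ 2 / (L : ℝ) ^ 2 := by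
      field_simp
    rw [e1]
    nlinarith [hP]
  exact le_of_mul_le_mul_left key hL2

end SlicePoincare

end Summit.HubbardSuperconductivity.HubbardSuperconductivity.Theorems

end
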